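import Literature.AlgebraicGeometry.Frobenioids.PerfectionSquareUnique
import Literature.AlgebraicGeometry.Frobenioids.PerfectionRigidity
import HarnessLib

/-!
# Frobenioids I, Theorem 3.4 (iii): the complete repaired perfection clause — `1`-unique square and
# rigidity of its composites (PROOFS, assembly)

Mochizuki, *The geometry of Frobenioids I: the general theory*, Kyushu J. Math. **62** (2008), Theorem
3.4 (iii), p. 62 l. 42 – p. 63 l. 2 [cite: MochizukiFrdI2008, Thm. 3.4 (iii) p.62]: "`Ψ` induces a `1`-unique
functor `Ψ^pf : C₁^pf → C₂^pf` that fits into a `1`-commutative diagram … Finally, if, moreover, `D₁`, `D₂`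
are slim, then each of the composite functors of this diagram is rigid."

Assembly, for THE perfections `PreFrobenioidData.perfection hF_i`, of the typer's repaired statement
`Thm34iii_pfR` (seat abc-iut-L1-t3, ruling T34pf-Q1; abc-iut cell GAP-LEDGER row G-L1d8-2) in the cell's
FSM form: the `1`-unique square `PfSquareR` (`PerfectionSquareUnique.lean`, seat abc-iut-L1-d1 —
existence / equivalence / `1`-commutativity from `PerfectionFunctoriality.lean`, structure-compatible
`1`-uniqueness from `map_unique_of_isFrobeniusCompatible`) together with the rigidity of the two composites
`Ψ ⋙ (C₂ → C₂^pf)` and `(C₁ → C₁^pf) ⋙ Ψ^pf` for `D₂` slim and `C₂` of Frobenius-normalized type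
(`PerfectionRigidity.lean`: `isRigidFunctor_toPf_comp_of_iso`, Prop. 1.13 (ii)).
* `PreFrobenioid.Perfection.pfSquareR_map_and_rigid` — general universes, `Ψ` an equivalence compatible
  with arrows of Frobenius type, `C₂` of Frobenius-isotropic type;
* `FrdI.thm34iii_pfR_of_isOfFSMType` — the instance over FSM-type bases (hypotheses of
  `FrdI.thm34iii_pfSquare_of_isOfFSMType` + `C₂` Frobenius-isotropic + Frobenius-normalized), literally
  `∃ Ψpf, PfSquareR ∧ (IsSlim D₁ → IsSlim D₂ → IsRigidFunctor (Ψ ⋙ toPf₂) ∧ IsRigidFunctor (toPf₁ ⋙ Ψpf))`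
  with the three conjuncts of `PfSquareR` spelled out.
No new definitions; nothing here is specific to the abc programme.
-/

namespace Literature.AlgebraicGeometry.Frobenioids

namespace PreFrobenioid

namespace Perfection

open CategoryTheory Opposite

universe w v v' u u' w₂ v₂ v₂' u₂ u₂'

variable {D₁ : Type u} [Category.{v} D₁] {Φ₁ : D₁ᵒᵖ ⥤ CommMonCat.{w}}
  {C₁ : Type u'} [Category.{v'} C₁] {F₁ : C₁ ⥤ ElemFrobenioid Φ₁} {hF₁ : IsFrobenioid F₁}
  {D₂ : Type u₂} [Category.{v₂} D₂] {Φ₂ : D₂ᵒᵖ ⥤ CommMonCat.{w₂}}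
  {C₂ : Type u₂'} [Category.{v₂'} C₂] {F₂ : C₂ ⥤ ElemFrobenioid Φ₂} {hF₂ : IsFrobenioid F₂}

/-- **Theorem 3.4 (iii), the complete repaired perfection clause** for THE perfections and an equivalence
`Ψ` compatible with arrows of Frobenius type, `C₂` of Frobenius-isotropic type: the `1`-unique square
`PfSquareR` for `Ψ^pf = Perfection.map` (equivalence; `Ψ ⋙ (C₂ → C₂^pf) ≅ (C₁ → C₁^pf) ⋙ Ψ^pf`; uniqueness up
to isomorphism among functors compatible with the Frobenioid structures fitting the square), AND, for `D₂`
slim and `C₂` of Frobenius-normalized type, rigidity of both composite functors of the square.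
[cite: MochizukiFrdI2008, Thm. 3.4 (iii) p.62] -/
theorem pfSquareR_map_and_rigid (hiso₂ : IsOfType (IsFrobeniusIsotropic F₂)) (Ψ : C₁ ≌ C₂)
    (hΨ : IsFrobeniusCompatible F₁ F₂ Ψ.functor) :
    ((map (hF₁ := hF₁) (hF₂ := hF₂) hΨ).IsEquivalence ∧
      OneCommutes Ψ.functor (toPf hF₂) (toPf hF₁) (map (hF₁ := hF₁) (hF₂ := hF₂) hΨ) ∧
      ∀ B' : Perfection hF₁ ⥤ Perfection hF₂,
        PreFrobenioidData.PreservesMor B' (ops hF₁).IsFrobeniusType (ops hF₂).IsFrobeniusType →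
        (∀ ⦃X Y : Perfection hF₁⦄ (f : X ⟶ Y), (ops hF₁).IsFrobeniusType f →
          (ops hF₂).degFr (B'.map f) = (ops hF₁).degFr f) →
        OneCommutes Ψ.functor (toPf hF₂) (toPf hF₁) B' →
          Nonempty (B' ≅ map (hF₁ := hF₁) (hF₂ := hF₂) hΨ)) ∧
    (IsSlim D₂ → (PreFrobenioidData.ofFunctor Φ₂ F₂).IsOfFrobeniusNormalizedType →
      IsRigidFunctor (Ψ.functor ⋙ toPf hF₂) ∧ IsRigidFunctor (toPf hF₁ ⋙ map (hF₁ := hF₁) (hF₂ := hF₂) hΨ)) :=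
  ⟨pfSquareR_map hiso₂ Ψ hΨ, fun hD₂ hN₂ =>
    isRigidFunctor_toPf_comp_of_iso hF₂ hD₂ hN₂ Ψ (PreFrobenioidData.perfection hF₁).toPf
      (map (hF₁ := hF₁) (hF₂ := hF₂) hΨ) (toPfCompMapIso hΨ).symm⟩

end Perfection

end PreFrobenioid

/-! ### Over FSM-type bases -/

namespace FrdI

open CategoryTheory

universe w v v' u u'

variable {D₁ : Type u} [Category.{v} D₁] {Φ₁ : D₁ᵒᵖ ⥤ CommMonCat.{w}} {C₁ : Type u'}
  [Category.{v'} C₁] {D₂ : Type u} [Category.{v} D₂] {Φ₂ : D₂ᵒᵖ ⥤ CommMonCat.{w}} {C₂ : Type u'}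
  [Category.{v'} C₂] {F₁ : C₁ ⥤ ElemFrobenioid Φ₁} {F₂ : C₂ ⥤ ElemFrobenioid Φ₂}

/-- **Theorem 3.4 (iii), the complete repaired perfection clause `Thm34iii_pfR` over FSM-type bases**
(typer's shape, seat abc-iut-L1-t3): under the hypotheses of `thm34iii_pfSquare_of_isOfFSMType`
(`PerfectionSquareFSM.lean`: quasi-isotropic type, FSM-type bases, non-dilating divisor monoids, a
non-group-like object on each side), with `C₂` of Frobenius-isotropic type (print's standing hypothesis for
`C^pf`) and of Frobenius-normalized type (both part of "standard type"), for THE perfections there is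
`Ψ^pf : C₁^pf ⥤ C₂^pf` such that (1) `Ψ^pf` is an equivalence, (2) `Ψ ⋙ (C₂ → C₂^pf) ≅ (C₁ → C₁^pf) ⋙ Ψ^pf`,
(3) `Ψ^pf` is unique up to isomorphism among functors compatible with the Frobenioid structures fitting the
square, and (4) if `D₁`, `D₂` are slim, both composite functors of the square are rigid.
[cite: MochizukiFrdI2008, Thm. 3.4 (iii) p.62] -/
theorem thm34iii_pfR_of_isOfFSMType (hF₁ : PreFrobenioid.IsFrobenioid F₁)
    (hF₂ : PreFrobenioid.IsFrobenioid F₂) (hq₁ : (PreFrobenioidData.ofFunctor Φ₁ F₁).IsOfQuasiIsotropicType)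
    (hq₂ : (PreFrobenioidData.ofFunctor Φ₂ F₂).IsOfQuasiIsotropicType) (hD₁ : IsOfFSMType D₁)
    (hD₂ : IsOfFSMType D₂) (hnd₁ : (PreFrobenioidData.ofFunctor Φ₁ F₁).IsNonDilatingOn)
    (hnd₂ : (PreFrobenioidData.ofFunctor Φ₂ F₂).IsNonDilatingOn) (Ψ : C₁ ≌ C₂)
    (hN₁ : ∃ A : C₁, ¬ (PreFrobenioidData.ofFunctor Φ₁ F₁).IsGroupLikeObj A)
    (hN₂ : ∃ A : C₂, ¬ (PreFrobenioidData.ofFunctor Φ₂ F₂).IsGroupLikeObj A)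
    (hiso₂ : PreFrobenioid.IsOfType (PreFrobenioid.IsFrobeniusIsotropic F₂))
    (hfn₂ : (PreFrobenioidData.ofFunctor Φ₂ F₂).IsOfFrobeniusNormalizedType) :
    ∃ Ψpf : (PreFrobenioidData.perfection hF₁).Pf ⥤ (PreFrobenioidData.perfection hF₂).Pf,
      (Ψpf.IsEquivalence ∧
        OneCommutes Ψ.functor (PreFrobenioidData.perfection hF₂).toPf (PreFrobenioidData.perfection hF₁).toPf
          Ψpf ∧
        ∀ B' : (PreFrobenioidData.perfection hF₁).Pf ⥤ (PreFrobenioidData.perfection hF₂).Pf,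
          PreFrobenioidData.PreservesMor B' (PreFrobenioidData.perfection hF₁).ops.IsFrobeniusType
              (PreFrobenioidData.perfection hF₂).ops.IsFrobeniusType →
            (∀ ⦃X Y : (PreFrobenioidData.perfection hF₁).Pf⦄ (f : X ⟶ Y),
                (PreFrobenioidData.perfection hF₁).ops.IsFrobeniusType f →
                  (PreFrobenioidData.perfection hF₂).ops.degFr (B'.map f) =
                    (PreFrobenioidData.perfection hF₁).ops.degFr f) →
            OneCommutes Ψ.functor (PreFrobenioidData.perfection hF₂).toPf
                (PreFrobenioidData.perfection hF₁).toPf B' →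
              Nonempty (B' ≅ Ψpf)) ∧
      (IsSlim D₁ → IsSlim D₂ →
        IsRigidFunctor (Ψ.functor ⋙ (PreFrobenioidData.perfection hF₂).toPf) ∧
          IsRigidFunctor ((PreFrobenioidData.perfection hF₁).toPf ⋙ Ψpf)) := by
  have hΨ := isFrobeniusCompatible_of_isOfFSMType hF₁ hF₂ hq₁ hq₂ hD₁ hD₂ hnd₁ hnd₂ Ψ hN₁ hN₂
  obtain ⟨hsq, hrig⟩ := PreFrobenioid.Perfection.pfSquareR_map_and_rigid (hF₁ := hF₁) (hF₂ := hF₂) hiso₂ Ψ hΨ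
  exact ⟨PreFrobenioid.Perfection.map (hF₁ := hF₁) (hF₂ := hF₂) hΨ, hsq, fun _ hD₂' => hrig hD₂' hfn₂⟩

end FrdI

end Literature.AlgebraicGeometry.Frobenioids
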